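import Mathlib
import HarnessLib

/-!
# Limits of `K(ε)`-subspaces at `ε = 0` and their dimension (tools for elementary border apolarity)

Topic `Literature/Computability/AlgebraicComplexity`.  Support file for the proof of
`Landsberg2005_borderRank_matMulTensor_two` (`R̲(⟨2,2,2⟩) = 7`, `BorderRankMatMulSmall.lean`) by an
elementary, torus-only version of the border apolarity method of Buczyńska–Buczyński and
Conner–Harper–Landsberg 2023, §2.3–§3, carried out for the tree's ALGEBRAIC border rank over `K[ε]`
(`algBorderRank`, `SchoenhageTau.lean`).  Everything here is general linear algebra, PROVED:

* `polyVec`, `latt W`, `ev0ₗ`, `limSub W` — for an `L`-subspace `W ≤ L^n`, `L = K(ε)` the fraction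
  field of `K[ε]`, the lattice `W ∩ K[ε]^n` of its polynomial vectors and the LIMIT subspace
  `lim_{ε→0} W := {f(0) : f ∈ W ∩ K[ε]^n} ≤ K^n` (the limit point of the curve `ε ↦ W(ε)` in the
  Grassmannian, written without Plücker coordinates; CHL 2023, §2.3 "`I_{ijk} := lim_{t→0} I_{ijk,t}`
  … the limit is taken in the Grassmannian").
* `finrank_limSub_eq` — **`dim_K lim W = dim_L W`**.  `≤`: polynomial vectors with `K`-independent
  constant terms are `L`-independent (lowest-order coefficient of a cleared-denominator relation);
  `≥`: by the Smith normal form of the lattice inside `K[ε]^n` (Mathlib, PID `K[ε]`) and the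
  saturation of the lattice, the lattice is spanned by part of a `K[ε]`-basis of `K[ε]^n`, whose
  constant terms form a `K`-basis of `K^n`.
* `det_ne_zero_of_degree_lt` — a square polynomial matrix congruent to `εᵐ · 1` modulo entries of
  degree `< m` has nonzero (monic) determinant: the general-position certificate for perturbed
  border rank decompositions.

## References

* A. Conner, A. Harper, J. M. Landsberg, *New lower bounds for matrix multiplication and `det₃`*,
  Forum Math. Pi 11 (2023) e17 = arXiv:1911.07981, §2.3 (multigraded ideal of a border rank
  decomposition and its limit). [ConnerHarperLandsberg2023]
* W. Buczyńska, J. Buczyński, *Apolarity, border rank, and multigraded Hilbert scheme*, Duke Math. J.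
  170 (2021) — the border apolarity theorem (cited through CHL 2023, §2.3).
-/

noncomputable section

open scoped BigOperators Polynomial
open Polynomial

namespace Literature.Computability.AlgebraicComplexity

universe u v w

/-! ## Polynomial vectors inside `L^n` and the limit subspace -/

section Limits

variable {K : Type u} [Field K] (L : Type v) [Field L] [Algebra K[X] L]
variable {n : Type w}

/-- The coefficientwise embedding `K[ε]^n → L^n`, `L = K(ε)`. [folklore] -/
def polyVec (f : n → K[X]) : n → L := fun j => algebraMap K[X] L (f j)

/-- Unfolding lemma for `polyVec`. [folklore] -/
@[simp] theorem polyVec_apply (f : n → K[X]) (j : n) : polyVec L f j = algebraMap K[X] L (f j) := rfl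

/-- `polyVec` as a `K[ε]`-linear map. [folklore] -/
def polyVecₗ : (n → K[X]) →ₗ[K[X]] (n → L) where
  toFun := polyVec L
  map_add' f g := by funext j; simp [polyVec]
  map_smul' c f := by funext j; simp [polyVec, Algebra.smul_def]

/-- Unfolding lemma for `polyVecₗ`. [folklore] -/
@[simp] theorem polyVecₗ_apply (f : n → K[X]) : polyVecₗ L f = polyVec L f := rfl

variable (K) in
/-- The LATTICE of an `L`-subspace `W ≤ L^n`: its polynomial vectors `W ∩ K[ε]^n`, a
`K[ε]`-submodule of `K[ε]^n`. [cite: ConnerHarperLandsberg2023, §2.3] -/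
def latt (W : Submodule L (n → L)) : Submodule K[X] (n → K[X]) :=
  (W.restrictScalars K[X]).comap (polyVecₗ L)

/-- Membership in the lattice. [folklore] -/
theorem mem_latt {W : Submodule L (n → L)} {f : n → K[X]} : f ∈ latt K L W ↔ polyVec L f ∈ W :=
  Iff.rfl

/-- Constant terms: `K[ε]^n → K^n`, `f ↦ f(0)` (a `K`-linear map). [folklore] -/
def ev0ₗ : (n → K[X]) →ₗ[K] (n → K) where
  toFun f j := (f j).coeff 0
  map_add' f g := by funext j; simp
  map_smul' c f := by funext j; simp

/-- Unfolding lemma for `ev0ₗ`. [folklore] -/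
@[simp] theorem ev0ₗ_apply (f : n → K[X]) (j : n) : ev0ₗ (K := K) f j = (f j).coeff 0 := rfl

/-- `(c • f)(0) = c(0) • f(0)`. [folklore] -/
theorem ev0ₗ_smul (c : K[X]) (f : n → K[X]) : ev0ₗ (K := K) (c • f) = c.coeff 0 • ev0ₗ f := by
  funext j
  simp [Polynomial.mul_coeff_zero]

/-- `(C ∘ y)(0) = y`. [folklore] -/
theorem ev0ₗ_C_comp (y : n → K) : ev0ₗ (K := K) (fun j => C (y j)) = y := by
  funext j
  simp

variable (K) in
/-- The LIMIT at `ε = 0` of an `L`-subspace `W ≤ L^n` (`L = K(ε)`): the constant terms of its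
polynomial vectors, `lim W = {f(0) : f ∈ W ∩ K[ε]^n} ≤ K^n` — the limit point `lim_{t→0} W_t` in the
Grassmannian of CHL 2023, §2.3, for a subspace defined over `K(t)`. [cite: ConnerHarperLandsberg2023, §2.3] -/
def limSub (W : Submodule L (n → L)) : Submodule K (n → K) :=
  ((latt K L W).restrictScalars K).map ev0ₗ

/-- A polynomial vector of `W` contributes its constant term to `lim W`. [folklore] -/
theorem ev0_mem_limSub {W : Submodule L (n → L)} {f : n → K[X]} (hf : f ∈ latt K L W) :
    ev0ₗ f ∈ limSub K L W :=
  Submodule.mem_map_of_mem (f := ev0ₗ) (p := (latt K L W).restrictScalars K) hf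

/-- Elements of `lim W` are constant terms of polynomial vectors of `W`. [folklore] -/
theorem mem_limSub_iff {W : Submodule L (n → L)} {y : n → K} :
    y ∈ limSub K L W ↔ ∃ f : n → K[X], f ∈ latt K L W ∧ ev0ₗ f = y := by
  simp [limSub]

variable (K) in
/-- `lim` is monotone. [folklore] -/
theorem limSub_mono {W W' : Submodule L (n → L)} (h : W ≤ W') : limSub K L W ≤ limSub K L W' := by
  rintro y hy
  obtain ⟨f, hf, rfl⟩ := (mem_limSub_iff (K := K) L).1 hy
  exact ev0_mem_limSub (K := K) L (h hf)

variable [IsFractionRing K[X] L]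

/-- `polyVec` is injective (coefficientwise injectivity of `K[ε] → K(ε)`). [folklore] -/
theorem polyVec_injective : Function.Injective (polyVec (n := n) L : (n → K[X]) → n → L) := by
  intro f g h
  funext j
  exact IsFractionRing.injective K[X] L (congr_fun h j)

/-- The lattice is SATURATED: `c • f ∈ W ∩ K[ε]^n` with `c ≠ 0` forces `f ∈ W ∩ K[ε]^n` (`W` is an
`L`-subspace and `c` is invertible in `L`). [folklore] -/
theorem smul_mem_latt_iff {W : Submodule L (n → L)} {c : K[X]} (hc : c ≠ 0) {f : n → K[X]} :
    c • f ∈ latt K L W ↔ f ∈ latt K L W := by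
  have hc' : algebraMap K[X] L c ≠ 0 := fun h =>
    hc ((IsFractionRing.to_map_eq_zero_iff (K := L)).1 h)
  have hsm : polyVec L (c • f) = algebraMap K[X] L c • polyVec L f := by
    funext j; simp [polyVec]
  rw [mem_latt, mem_latt, hsm]
  constructor
  · intro h
    have := W.smul_mem (algebraMap K[X] L c)⁻¹ h
    rwa [smul_smul, inv_mul_cancel₀ hc', one_smul] at this
  · intro h
    exact W.smul_mem _ h

/-- Below the least trailing degree of `F`, `(F · f)[e] = F[e] · f[0]`. [folklore] -/
theorem coeff_mul_of_coeff_lt_eq_zero {F f : K[X]} {e : ℕ} (hF : ∀ x < e, F.coeff x = 0) :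
    (F * f).coeff e = F.coeff e * f.coeff 0 := by
  rw [coeff_mul, Finset.sum_eq_single (e, 0)]
  · rintro ⟨x, y⟩ hxy hne
    have hxy' : x + y = e := by simpa using hxy
    have hx : x < e := by
      rcases Nat.lt_or_ge x e with h | h
      · exact h
      · exfalso
        have : x = e := by omega
        subst this
        have : y = 0 := by omega
        exact hne (by rw [this])
    rw [hF x hx, zero_mul]
  · intro h
    exact absurd (by simp) h

/-- **Polynomial vectors with `K`-independent constant terms are `L`-independent.** (If
`∑ gᵢ fᵢ = 0` over `L`, clear denominators and read off the lowest-order coefficient.) [folklore] -/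
theorem linearIndependent_polyVec_of_ev0 {m : Type*} [Fintype m] (f : m → n → K[X])
    (h : LinearIndependent K (fun i => ev0ₗ (K := K) (f i))) :
    LinearIndependent L (fun i => polyVec L (f i)) := by
  classical
  rw [Fintype.linearIndependent_iff]
  intro g hg
  obtain ⟨b, hb⟩ := IsLocalization.exist_integer_multiples (nonZeroDivisors K[X]) Finset.univ g
  choose F hF using fun i => hb i (Finset.mem_univ i)
  have hb0 : algebraMap K[X] L (b : K[X]) ≠ 0 :=
    IsFractionRing.to_map_ne_zero_of_mem_nonZeroDivisors b.2
  -- the polynomial relation `∑ F i * f i j = 0`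
  have hrel : ∀ j, ∑ i, F i * f i j = 0 := by
    intro j
    apply IsFractionRing.injective K[X] L
    have hj := congr_fun hg j
    rw [Finset.sum_apply, Pi.zero_apply] at hj
    rw [map_sum, map_zero]
    calc ∑ i, algebraMap K[X] L (F i * f i j)
        = ∑ i, algebraMap K[X] L (b : K[X]) * (g i • polyVec L (f i)) j := by
          refine Finset.sum_congr rfl fun i _ => ?_
          rw [map_mul, hF i, Pi.smul_apply, smul_eq_mul, polyVec_apply, Algebra.smul_def, mul_assoc]
      _ = 0 := by rw [← Finset.mul_sum, hj, mul_zero]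
  suffices hF0 : ∀ i, F i = 0 by
    intro i
    have hi := hF i
    rw [hF0 i, map_zero, Algebra.smul_def] at hi
    exact (mul_eq_zero.1 hi.symm).resolve_left hb0
  by_contra hne
  push Not at hne
  obtain ⟨i₀, hi₀⟩ := hne
  obtain ⟨i₁, hi₁, hmin⟩ := Finset.exists_min_image (Finset.univ.filter fun i => F i ≠ 0)
    (fun i => (F i).natTrailingDegree) ⟨i₀, by simpa using hi₀⟩
  rw [Finset.mem_filter] at hi₁
  set e := (F i₁).natTrailingDegree with he
  have hlow : ∀ i, ∀ x < e, (F i).coeff x = 0 := by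
    intro i x hx
    by_cases hx0 : F i = 0
    · rw [hx0, coeff_zero]
    · exact coeff_eq_zero_of_lt_natTrailingDegree (hx.trans_le (hmin i (by simpa using hx0)))
  -- the coefficient of `ε^e` of the relation is a `K`-relation among the constant terms
  have hK : ∑ i, (F i).coeff e • ev0ₗ (K := K) (f i) = 0 := by
    funext j
    rw [Finset.sum_apply, Pi.zero_apply]
    have := congrArg (fun P : K[X] => P.coeff e) (hrel j)
    simp only [finsetSum_coeff, coeff_zero] at this
    rw [← this]
    refine Finset.sum_congr rfl fun i _ => ?_
    rw [Pi.smul_apply, smul_eq_mul, ev0ₗ_apply, coeff_mul_of_coeff_lt_eq_zero (hlow i)]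
  have hcoeff := (Fintype.linearIndependent_iff.1 h _ hK) i₁
  have : (F i₁).trailingCoeff = 0 := hcoeff
  exact hi₁.2 (trailingCoeff_eq_zero.1 this)

variable [Fintype n]

variable (K) in
/-- **`dim_K lim W ≤ dim_L W`.** [cite: ConnerHarperLandsberg2023, §2.3] -/
theorem finrank_limSub_le (W : Submodule L (n → L)) :
    Module.finrank K (limSub K L W) ≤ Module.finrank L W := by
  classical
  set m := Module.finrank K (limSub K L W)
  let b := Module.finBasis K (limSub K L W)
  have hmem : ∀ i, ∃ f : n → K[X], f ∈ latt K L W ∧ ev0ₗ f = (b i : n → K) :=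
    fun i => (mem_limSub_iff (K := K) L).1 (b i).2
  choose f hf hfe using hmem
  have hli : LinearIndependent K (fun i => ev0ₗ (K := K) (f i)) := by
    have : (fun i => ev0ₗ (K := K) (f i)) = (limSub K L W).subtype ∘ b := by
      funext i; exact hfe i
    rw [this]
    exact b.linearIndependent.map' _ (Submodule.ker_subtype _)
  have hL := linearIndependent_polyVec_of_ev0 (K := K) L f hli
  let g : Fin m → W := fun i => ⟨polyVec L (f i), hf i⟩
  have hg : LinearIndependent L g := LinearIndependent.of_comp W.subtype hL
  simpa using hg.fintype_card_le_finrank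

variable (K) in
/-- **`dim_L W ≤ dim_K lim W`** — through the Smith normal form of the lattice `W ∩ K[ε]^n` in
`K[ε]^n` (PID) and its saturation: the lattice is spanned by a subfamily `(b_{f i})_{i<k}` of a
`K[ε]`-basis `b` of `K[ε]^n`, `k ≥ dim_L W`, and the constant terms `b_j(0)` form a `K`-basis of
`K^n`. [cite: ConnerHarperLandsberg2023, §2.3] -/
theorem finrank_le_finrank_limSub (W : Submodule L (n → L)) :
    Module.finrank L W ≤ Module.finrank K (limSub K L W) := by
  classical
  obtain ⟨k, snf⟩ := Submodule.smithNormalForm (Pi.basisFun K[X] n) (latt K L W)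
  -- (i) the diagonal entries are nonzero, so by saturation `bM (f i) ∈ latt W`
  have ha : ∀ i, snf.a i ≠ 0 := by
    intro i h0
    have h := snf.snf i
    rw [h0, zero_smul] at h
    exact snf.bN.ne_zero i (Subtype.ext h)
  have hg : ∀ i, snf.bM (snf.f i) ∈ latt K L W := by
    intro i
    rw [← smul_mem_latt_iff (K := K) L (ha i), ← snf.snf i]
    exact (snf.bN i).2
  -- (ii) the constant terms of `bM` form a basis of `K^n`
  set e : n → (n → K) := fun j => ev0ₗ (K := K) (snf.bM j) with he_def
  have htop : ⊤ ≤ Submodule.span K (Set.range e) := by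
    intro y _
    set yt : n → K[X] := fun j => C (y j)
    have hy : y = ev0ₗ (K := K) yt := (ev0ₗ_C_comp y).symm
    rw [hy, ← snf.bM.sum_repr yt, map_sum]
    refine Submodule.sum_mem _ fun j _ => ?_
    rw [ev0ₗ_smul]
    exact Submodule.smul_mem _ _ (Submodule.subset_span ⟨j, rfl⟩)
  have hli : LinearIndependent K e :=
    linearIndependent_of_top_le_span_of_card_eq_finrank htop
      (Module.finrank_fintype_fun_eq_card K).symm
  -- (iii) `k ≤ dim_K lim W`
  have h1 : k ≤ Module.finrank K (limSub K L W) := by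
    let e' : Fin k → limSub K L W := fun i => ⟨e (snf.f i), ev0_mem_limSub (K := K) L (hg i)⟩
    have he' : LinearIndependent K e' := by
      apply LinearIndependent.of_comp (limSub K L W).subtype
      exact hli.comp snf.f snf.f.injective
    simpa using he'.fintype_card_le_finrank
  -- (iv) `dim_L W ≤ k`: `W` is spanned over `L` by the lattice, which has `k` generators
  have h2 : Module.finrank L W ≤ k := by
    set v : Fin k → (n → L) := fun i => polyVec L (snf.bN i : n → K[X])
    have hW : W ≤ Submodule.span L (Set.range v) := by
      intro w hw
      obtain ⟨b, hb⟩ := IsLocalization.exist_integer_multiples (nonZeroDivisors K[X]) Finset.univ w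
      choose F hF using fun j => hb j (Finset.mem_univ j)
      have hb0 : algebraMap K[X] L (b : K[X]) ≠ 0 :=
        IsFractionRing.to_map_ne_zero_of_mem_nonZeroDivisors b.2
      have hFw : polyVec L F = algebraMap K[X] L (b : K[X]) • w := by
        funext j
        rw [polyVec_apply, hF j, Pi.smul_apply, Algebra.smul_def]
        rfl
      have hFl : F ∈ latt K L W := by
        rw [mem_latt, hFw]
        exact W.smul_mem _ hw
      have hFspan : polyVec L F ∈ Submodule.span L (Set.range v) := by
        have hrepr := snf.bN.sum_repr ⟨F, hFl⟩
        have hF' : F = ∑ i, (snf.bN.repr ⟨F, hFl⟩ i) • (snf.bN i : n → K[X]) := by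
          have := congrArg (fun x : latt K L W => (x : n → K[X])) hrepr
          rw [Submodule.coe_sum] at this
          exact this.symm
        rw [hF', ← polyVecₗ_apply, map_sum]
        refine Submodule.sum_mem _ fun i _ => ?_
        rw [map_smul, polyVecₗ_apply, algebra_compatible_smul L (snf.bN.repr ⟨F, hFl⟩ i)]
        exact Submodule.smul_mem _ _ (Submodule.subset_span ⟨i, rfl⟩)
      have hw' : w = (algebraMap K[X] L (b : K[X]))⁻¹ • polyVec L F := by
        rw [hFw, smul_smul, inv_mul_cancel₀ hb0, one_smul]
      rw [hw']
      exact Submodule.smul_mem _ _ hFspan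
    have hcard : Module.finrank L (Submodule.span L (Set.range v)) ≤ Fintype.card (Fin k) :=
      finrank_range_le_card (R := L) v
    rw [Fintype.card_fin] at hcard
    exact (Submodule.finrank_mono hW).trans hcard
  exact h2.trans h1

variable (K) in
/-- **`dim_K lim_{ε→0} W = dim_L W`**: the limit of a `K(ε)`-subspace is a `K`-subspace of the same
dimension (the Grassmannian is proper). [cite: ConnerHarperLandsberg2023, §2.3] -/
theorem finrank_limSub_eq (W : Submodule L (n → L)) :
    Module.finrank K (limSub K L W) = Module.finrank L W :=
  le_antisymm (finrank_limSub_le K L W) (finrank_le_finrank_limSub K L W)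

end Limits

/-! ## A general-position certificate: `det (εᵐ · 1 + lower degree) ≠ 0` -/

section MonicDet

variable {K : Type u} [Field K] {r : Type w} [Fintype r] [DecidableEq r]

/-- **`det M ≠ 0` for a polynomial matrix `M ≡ εᵐ · 1` modulo entries of degree `< m`**: in the
Leibniz expansion the identity permutation contributes the monic term `∏ᵢ Mᵢᵢ` of degree `|r| m`,
every other permutation a term of smaller degree. [folklore] -/
theorem det_ne_zero_of_degree_lt (m : ℕ) (M : Matrix r r K[X])
    (hdiag : ∀ i, (M i i - X ^ m).degree < (m : WithBot ℕ))
    (hoff : ∀ i j, i ≠ j → (M i j).degree < (m : WithBot ℕ)) :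
    M.det ≠ 0 := by
  classical
  -- the diagonal entries are monic of degree `m`
  have hmon : ∀ i, (M i i).Monic ∧ (M i i).natDegree = m := by
    intro i
    have e : M i i = X ^ m + (M i i - X ^ m) := by ring
    refine ⟨e ▸ monic_X_pow_add (hdiag i), ?_⟩
    rw [e]
    have hd : (X ^ m + (M i i - X ^ m)).degree = (m : WithBot ℕ) := by
      have hXm : ((X : K[X]) ^ m).degree = (m : WithBot ℕ) := degree_X_pow m
      rw [degree_add_eq_left_of_degree_lt (hXm ▸ hdiag i), hXm]
    exact natDegree_eq_of_degree_eq_some hd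
  set N := Fintype.card r * m with hN
  -- the identity term
  have hp1 : (∏ i, M i i).Monic := monic_prod_of_monic _ _ fun i _ => (hmon i).1
  have hp1deg : (∏ i, M i i).natDegree = N := by
    rw [natDegree_prod_of_monic _ _ fun i _ => (hmon i).1]
    simp [(hmon _).2, hN]
  -- every other permutation gives a term of degree `< N`
  have hlt : ∀ σ : Equiv.Perm r, σ ≠ 1 → (∏ i, M (σ i) i).degree < N := by
    intro σ hσ
    obtain ⟨i₀, hi₀⟩ : ∃ i₀, σ i₀ ≠ i₀ := by
      by_contra h
      push Not at h
      exact hσ (Equiv.ext h)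
    by_cases hz : ∃ i, M (σ i) i = 0
    · obtain ⟨i, hi⟩ := hz
      rw [Finset.prod_eq_zero (f := fun j => M (σ j) j) (Finset.mem_univ i) hi, degree_zero]
      exact WithBot.bot_lt_coe N
    push Not at hz
    have hle : ∀ i, (M (σ i) i).natDegree ≤ m := by
      intro i
      by_cases h : σ i = i
      · rw [h, (hmon i).2]
      · exact ((natDegree_lt_iff_degree_lt (hz i)).2 (hoff _ _ h)).le
    have hsum : ∑ i, (M (σ i) i).natDegree < N := by
      calc ∑ i, (M (σ i) i).natDegree < ∑ _i : r, m :=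
            Finset.sum_lt_sum (fun i _ => hle i)
              ⟨i₀, Finset.mem_univ _, (natDegree_lt_iff_degree_lt (hz i₀)).2 (hoff _ _ hi₀)⟩
        _ = N := by simp [hN]
    have hne : ∏ i, M (σ i) i ≠ 0 := Finset.prod_ne_zero_iff.2 fun i _ => hz i
    rw [degree_eq_natDegree hne, Nat.cast_lt, natDegree_prod _ _ fun i _ => hz i]
    exact hsum
  -- assemble
  rw [Matrix.det_apply, Fintype.sum_eq_add_sum_compl 1]
  simp only [Equiv.Perm.sign_one, one_smul, Equiv.Perm.coe_one, id_eq]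
  refine (hp1.add_of_left ?_).ne_zero
  rw [degree_eq_natDegree hp1.ne_zero, hp1deg]
  refine lt_of_le_of_lt (degree_sum_le _ _) ?_
  refine (Finset.sup_lt_iff (WithBot.bot_lt_coe N)).2 fun σ hσ => ?_
  rw [Finset.mem_compl, Finset.mem_singleton] at hσ
  have hsmul : (Equiv.Perm.sign σ • ∏ i, M (σ i) i).degree ≤ (∏ i, M (σ i) i).degree := by
    rw [Units.smul_def, zsmul_eq_mul]
    calc _ ≤ (((Equiv.Perm.sign σ : ℤ) : K[X])).degree + (∏ i, M (σ i) i).degree :=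
          degree_mul_le _ _
      _ ≤ 0 + (∏ i, M (σ i) i).degree := add_le_add_left (degree_intCast_le _) _
      _ = _ := zero_add _
  exact hsmul.trans_lt (hlt σ hσ)

end MonicDet

end Literature.Computability.AlgebraicComplexity

end
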